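import Mathlib
import Literature.Analysis.FunctionSpaces.BochnerProofs
import HarnessLib

/-!
# Stub S2 `stub_bochnerRepresentation` of line `Sketch`, crux `EmbeddedDrudeMourre.DrudeDissolution`
(stmt-AtomisticToContinuum-12593): Bochner representation of a real continuous function of positive type

Pure analysis (`--supports stmt-AtomisticToContinuum-12593`). A continuous `C : ℝ → ℝ` whose
complexification `t ↦ (C t : ℂ)` is positive definite is the cosine transform of a finite measure:
`C t = ∫ cos (ω t) dσ(ω)`.

Proof: `0 ≤ C 0` and `|C x| ≤ C 0`
(`Literature.Analysis.FunctionSpaces.IsPositiveDefinite.norm_apply_le_holds`). If `C 0 = 0` then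
`C ≡ 0` and `σ = 0` works. Otherwise `(C 0)⁻¹ • C` is continuous, positive definite and equal to
`1` at `0`, hence the characteristic function of a probability measure `μ` on `ℝ` (Bochner's
theorem, in tree: `Literature.Analysis.FunctionSpaces.IsPositiveDefinite.exists_charFun_eq_holds`),
and `σ = (C 0) • μ` works since `re (charFun μ t) = ∫ cos (ω t) dμ(ω)`.

## Contents
* `isPositiveDefinite_ofReal_const_mul` — scaling a real positive-type function by `a ≥ 0`;
* `charFun_re_eq_integral_cos` — `re (charFun μ t) = ∫ cos (ω t) dμ(ω)` for a finite measure
  on `ℝ`;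
* `stub_bochnerRepresentation` — the registered stub, verbatim.
-/

noncomputable section

open MeasureTheory Filter Set Complex
open scoped Topology ENNReal NNReal Real ComplexConjugate

namespace Summit.AtomisticToContinuum.FouriersLaw.Theorems.DrudeDissolution.LineSketch

open Literature.Analysis.FunctionSpaces

/-- Scaling a real function of positive type by a non-negative real `a` keeps it of positive type:
the Hermitian double sum is multiplied by the real scalar `a`. -/
theorem isPositiveDefinite_ofReal_const_mul {C : ℝ → ℝ}
    (hC : IsPositiveDefinite (fun t : ℝ => ((C t : ℝ) : ℂ))) {a : ℝ} (ha : 0 ≤ a) :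
    IsPositiveDefinite (fun t : ℝ => ((a * C t : ℝ) : ℂ)) := by
  intro n x c
  have hsum : (∑ i, ∑ j, conj (c i) * c j * (fun t : ℝ => ((a * C t : ℝ) : ℂ)) (x j - x i)) =
      (a : ℂ) * ∑ i, ∑ j, conj (c i) * c j * (fun t : ℝ => ((C t : ℝ) : ℂ)) (x j - x i) := by
    simp only [Finset.mul_sum]
    refine Finset.sum_congr rfl fun i _ => Finset.sum_congr rfl fun j _ => ?_
    push_cast
    ring
  obtain ⟨hre, him⟩ := hC n x c
  refine ⟨?_, ?_⟩
  · rw [hsum, Complex.re_ofReal_mul]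
    exact mul_nonneg ha hre
  · rw [hsum, Complex.im_ofReal_mul, him, mul_zero]

/-- The real part of the characteristic function of a finite measure on `ℝ` is its cosine
transform: `re (charFun μ t) = ∫ cos (ω t) dμ(ω)`. -/
theorem charFun_re_eq_integral_cos (μ : Measure ℝ) [IsFiniteMeasure μ] (t : ℝ) :
    (charFun μ t).re = ∫ ω, Real.cos (ω * t) ∂μ := by
  rw [charFun_apply_real]
  have hmeas : AEStronglyMeasurable (fun x : ℝ => cexp (t * x * I)) μ :=
    (Continuous.aestronglyMeasurable (by fun_prop))
  have hint : Integrable (fun x : ℝ => cexp (t * x * I)) μ := by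
    refine (integrable_const (1 : ℝ)).mono' hmeas (Eventually.of_forall fun x => ?_)
    exact le_of_eq (by rw [← Complex.ofReal_mul]; exact Complex.norm_exp_ofReal_mul_I _)
  have h := integral_re hint
  simp only [RCLike.re_to_complex] at h
  rw [← h]
  congr 1
  ext x
  rw [← Complex.ofReal_mul, Complex.exp_ofReal_mul_I_re, mul_comm]

/-- **S2 `stub_bochnerRepresentation` — Bochner representation of a real continuous function of
positive type** (Bochner 1933, Satz 22; in tree as
`Literature.Analysis.FunctionSpaces.IsPositiveDefinite.exists_charFun_eq_holds`). A continuous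
`C : ℝ → ℝ` whose complexification is positive definite is the cosine transform of a finite
measure: `C t = ∫ cos (ω t) dσ(ω)` (`σ = C 0 • μ` with `μ` the Bochner probability measure of
`(C 0)⁻¹ • C`; `C 0 = 0 ⇒ C ≡ 0`, `σ = 0`). -/
theorem stub_bochnerRepresentation :
    ∀ C : ℝ → ℝ, Continuous C →
      Literature.Analysis.FunctionSpaces.IsPositiveDefinite (fun t : ℝ => ((C t : ℝ) : ℂ)) →
      ∃ σ : MeasureTheory.Measure ℝ, MeasureTheory.IsFiniteMeasure σ ∧
        ∀ t : ℝ, C t = ∫ ω, Real.cos (ω * t) ∂σ := by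
  intro C hcont hpd
  have h0 : 0 ≤ C 0 := by
    have := hpd.apply_zero_re_nonneg
    simpa using this
  have hbound : ∀ x, |C x| ≤ C 0 := fun x => by
    have := IsPositiveDefinite.norm_apply_le_holds hpd x
    simpa using this
  rcases h0.eq_or_lt with h00 | hpos
  · -- `C 0 = 0`, so `C ≡ 0` and `σ = 0`
    refine ⟨0, inferInstance, fun t => ?_⟩
    have ht : C t = 0 := by
      have h := hbound t
      rw [← h00] at h
      exact abs_nonpos_iff.mp h
    rw [ht, integral_zero_measure]
  · -- `0 < C 0`: normalise, apply Bochner, rescale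
    have ha0 : 0 ≤ (C 0)⁻¹ := inv_nonneg.mpr h0
    have hpd' : IsPositiveDefinite (fun t : ℝ => (((C 0)⁻¹ * C t : ℝ) : ℂ)) :=
      isPositiveDefinite_ofReal_const_mul hpd ha0
    have hcont' : Continuous (fun t : ℝ => (((C 0)⁻¹ * C t : ℝ) : ℂ)) := by fun_prop
    have h1 : (fun t : ℝ => (((C 0)⁻¹ * C t : ℝ) : ℂ)) 0 = 1 := by
      show (((C 0)⁻¹ * C 0 : ℝ) : ℂ) = 1
      rw [inv_mul_cancel₀ hpos.ne', Complex.ofReal_one]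
    obtain ⟨μ, hμ, hμC⟩ :=
      IsPositiveDefinite.exists_charFun_eq_holds (V := ℝ) hpd' hcont' h1
    refine ⟨(C 0).toNNReal • μ, inferInstance, fun t => ?_⟩
    rw [integral_smul_nnreal_measure, ← charFun_re_eq_integral_cos μ t, hμC, NNReal.smul_def,
      Real.coe_toNNReal _ h0, smul_eq_mul]
    show C t = C 0 * (((C 0)⁻¹ * C t : ℝ) : ℂ).re
    rw [Complex.ofReal_re, ← mul_assoc, mul_inv_cancel₀ hpos.ne', one_mul]

end Summit.AtomisticToContinuum.FouriersLaw.Theorems.DrudeDissolution.LineSketch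

end
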